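import Summits.HubbardSuperconductivity.HubbardSuperconductivity.Theorems.SoloBlindPenaltyEnergyPrice
import Literature.MathematicalPhysics.QuantumLattice.HubbardGroundStateDoublonBound
import Literature.MathematicalPhysics.QuantumLattice.HubbardPairDensityCouplingFloor
import Literature.MathematicalPhysics.QuantumLattice.FreeFermionSectorEnergyDeviation
import Literature.MathematicalPhysics.QuantumLattice.SectorGroundProjContinuity
import Literature.MathematicalPhysics.QuantumLattice.PairFieldEvenSideLRO
import Literature.MathematicalPhysics.QuantumLattice.PairCorrelationsProofs
import HarnessLib

/-!
# The BCS-crutch axis: `d`-wave order in EVERY ground state of `H_Hubbard - g L⁻² ΔᴴΔ`, `g ≥ g₀`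

Solo programme `solo-HubbardSuperconductivity-blind`, structural Theorems 23–24. The summit asks
for `d`-wave long-range order `re ⟨φ, ΔᴴΔ φ⟩ ≥ c L⁴` (`Δ = pairField dWaveFormFactor L = √2 Δ_d`)
in EVERY ground state of the repulsive Hubbard torus `H = hubbardTorus 2 L 1 U` in the doped
sector `K_L = (2⌊(1-δ)L²/2⌋, S^z = 0)`. This file proves the summit's EXACT conclusion shape for
the one-parameter deformation

  `H_L(g) = hubbardTorus 2 L 1 U - (g / L²) · ΔᴴΔ`   (`g ≥ 0`; `g = 0` is the summit),

the Hubbard model with a mean-field-normalised reduced-BCS `d`-wave attraction ("crutch") added,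
as soon as `g` exceeds an explicit `g₀(U, δ)` — and shows what the summit adds to it.

Abstract part (`H`, `O` Hermitian on a finite-dimensional space, `K ≠ ⊥` invariant, `Λ_K(O) =
max spec(O|K) = -minEnergyOn (-O) K` the ORDER CEILING):
* `re_rayleigh_le_orderCeiling`, `exists_unit_eigen_orderCeiling` — `re⟨v,Ov⟩ ≤ Λ ‖v‖²` on `K`,
  with equality at a unit eigenvector `χ`;
* `groundState_re_rayleigh_ge_orderCeiling_sub` — **Theorem 23 (abstract).** If the unit sphere
  of `K` has `H`-energies in `[e₀, e₀ + w]`, then for `s > 0` EVERY unit ground state `φ` of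
  `H - 2s·O` on `K` has `re ⟨φ, O φ⟩ ≥ Λ - w/s` (Theorem 19(a) applied to `A = H - 2sO` with the
  penalty `sO` and the witness `χ`: its excess energy in `A + sO = H - sO` is at most `w`);
* `minEnergyOn_crutch_le`, `groundState_re_rayleigh_ge_of_minEnergyOn_crutch_le`,
  `crutch_groundState_order_monotone` — **Theorem 24 (energy form / monotonicity).** An `H`-ground
  state of order `≥ a` depresses `E_K(H - tO) ≤ E_K(H) - t a` for all `t ≥ 0`; conversely such a
  linear depression at ONE `t > 0` forces order `≥ a` on EVERY ground state of `H - tO`; and the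
  order of every ground state is monotone along the axis: `X(φ_{t₁}) ≤ X(φ_{t₂})` for `t₁ < t₂`.

Hubbard part (`O = ΔᴴΔ`, `K = (2n, 0)`, `2 ≤ 2n ≤ L²`, `L ≥ 3`, `U ≥ 0`):
* `re_expect_hubbardTorus_mem_Icc` — the unit sphere of `K` has energies in `[-8n, 8n + UL²]`
  (free band `|ε| ≤ 4`, `0 ≤ Σ n↑n↓ ≤ L²`);
* `hubbard_crutch_groundState_order_ge` — **Theorem 23.** If SOME vector of `K` has order
  `≥ Λ₀ ‖·‖²`, then EVERY unit ground state of `H_L(g)`, `g > 0`, has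
  `re ⟨φ, ΔᴴΔ φ⟩ ≥ Λ₀ - 2(8+U) L⁴ / g`;
* `hubbard_crutch_hasLongRangeOrder` — **Corollary (the summit's conclusion on the crutch axis).**
  Given a kinematic floor `Λ₀ = c L⁴` at all large sides (Theorem 22, `SoloBlindKinematicFloor`:
  `c = (1-δ)/4096`), every family of normalised sector ground states of `H_L(g)` with
  `g ≥ 4(8+U)/c` has `HasLongRangeOrder` of the `d`-wave pair correlations, verbatim as in
  `HubbardSuperconductivity` (with `H_L(g)` in place of `H_L(0)`).

Reading (report §9). Along the axis `g ↦ H_L(g)` the every-ground-state order is monotone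
(Theorem 24) and provably `≍ L⁴` for `g ≥ g₀ = O((8+U)/(1-δ))` by KINEMATICS ALONE (the ceiling
`Λ_L ≍ L⁴` is insensitive to `U`); the summit is the statement that it is still `≍ L⁴` at `g = 0`,
i.e. that the repulsion `U Σ n↑n↓` does by itself what the crutch does for `g ≥ g₀`. By Theorem 24
the summit is equivalent to its energy form `E_L(0) - E_L(g) ≥ c g L²` for all `g ≥ 0` PLUS the
statement that the `g → 0⁺` slope is attained by every ground state at `g = 0` — the same
limit-interchange wall (W3 of the report) in one more costume; no leverage is claimed.

References: J. Bardeen, L. N. Cooper, J. R. Schrieffer, Phys. Rev. 108 (1957) 1175 (the reduced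
interaction `-(g/V) Σ b†b`); N. N. Bogoliubov, Physica 26 (1960) S1 and D. J. Thouless, Phys. Rev.
117 (1960) 1256 (exact solubility of the reduced model at large volume); R. B. Griffiths, J. Math.
Phys. 5 (1964) 1215 (order parameters from energy derivatives). The finite-dimensional statements
are elementary. [this work]
-/

noncomputable section

namespace Summit.HubbardSuperconductivity.HubbardSuperconductivity.Theorems.CrutchAxis

open Matrix Literature.Probability.LatticeModels Literature.MathematicalPhysics.QuantumLattice
  Literature.MathematicalPhysics.QuantumLattice.EigenvalueContinuation
open scoped ComplexOrder

/-! ### Abstract crutch axis -/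

section Abstract

variable {ι : Type*} [Fintype ι]

/-- The Rayleigh quotient of `H + c O` splits (private: folklore, stated elsewhere in the tree). -/
private theorem re_rayleigh_add_ofReal_smul (H O : Matrix ι ι ℂ) (c : ℝ) (v : ι → ℂ) :
    (star v ⬝ᵥ (H + (c : ℂ) • O) *ᵥ v).re =
      (star v ⬝ᵥ H *ᵥ v).re + c * (star v ⬝ᵥ O *ᵥ v).re := by
  rw [add_mulVec, smul_mulVec, dotProduct_add, dotProduct_smul, Complex.add_re, smul_eq_mul,
    Complex.re_ofReal_mul]

/-- **The order ceiling bounds the order functional**: `re ⟨v, O v⟩ ≤ Λ_K(O) · re⟨v,v⟩` for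
`v ∈ K`, `Λ_K(O) = -minEnergyOn (-O) K = max spec (O|K)`. [folklore] -/
theorem re_rayleigh_le_orderCeiling {O : Matrix ι ι ℂ} (hO : O.IsHermitian)
    (K : Submodule ℂ (ι → ℂ)) {v : ι → ℂ} (hv : v ∈ K) :
    (star v ⬝ᵥ O *ᵥ v).re ≤ -((-O).minEnergyOn K) * (star v ⬝ᵥ v).re := by
  have h := minEnergyOn_mul_le_re_rayleigh hO.neg K hv
  rw [neg_mulVec, dotProduct_neg, Complex.neg_re] at h
  linarith

/-- **The order ceiling is attained** by a unit eigenvector of `O` in `K` (finite dimension).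
[folklore] -/
theorem exists_unit_eigen_orderCeiling {O : Matrix ι ι ℂ} (hO : O.IsHermitian)
    (K : Submodule ℂ (ι → ℂ)) (hOK : ∀ v ∈ K, O *ᵥ v ∈ K) (hK : K ≠ ⊥) :
    ∃ χ ∈ K, star χ ⬝ᵥ χ = 1 ∧ (star χ ⬝ᵥ O *ᵥ χ).re = -((-O).minEnergyOn K) := by
  obtain ⟨χ, hχK, hχ1, hχ⟩ := exists_unit_eigen_minEnergyOn hO.neg K
    (fun v hv => by rw [neg_mulVec]; exact K.neg_mem (hOK v hv)) hK
  refine ⟨χ, hχK, hχ1, ?_⟩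
  have h := _root_.Literature.MathematicalPhysics.QuantumLattice.re_rayleigh_of_eigen_minEnergyOn
    (-O) K hχ1 hχ
  rw [neg_mulVec, dotProduct_neg, Complex.neg_re] at h
  linarith

/-- **Theorem 23 (abstract crutch bound).** `H`, `O` Hermitian, `K ≠ ⊥` invariant under both, the
`H`-energies of the unit sphere of `K` in `[e₀, e₀ + w]`, `s > 0`. Then EVERY unit ground state `φ`
of the crutched operator `H - 2s·O` on `K` has `re ⟨φ, O φ⟩ ≥ Λ_K(O) - w / s`: apply Theorem 19(a)
to `A = H - 2sO`, penalty `sO`, witness the top eigenvector `χ` of `O|K`, whose excess energy in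
`A + sO = H - sO` is `≤ (e₀ + w - sΛ) - (e₀ - sΛ) = w`. [this work] -/
theorem groundState_re_rayleigh_ge_orderCeiling_sub [DecidableEq ι] {H O : Matrix ι ι ℂ}
    (hH : H.IsHermitian)
    (hO : O.IsHermitian) (K : Submodule ℂ (ι → ℂ)) (hHK : ∀ v ∈ K, H *ᵥ v ∈ K)
    (hOK : ∀ v ∈ K, O *ᵥ v ∈ K) (hK : K ≠ ⊥) {e₀ w : ℝ}
    (hlow : ∀ v ∈ K, star v ⬝ᵥ v = 1 → e₀ ≤ (star v ⬝ᵥ H *ᵥ v).re)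
    (hup : ∀ v ∈ K, star v ⬝ᵥ v = 1 → (star v ⬝ᵥ H *ᵥ v).re ≤ e₀ + w)
    {s : ℝ} (hs : 0 < s) {φ : ι → ℂ} (hφK : φ ∈ K) (hφ1 : star φ ⬝ᵥ φ = 1)
    (hφ : (H + ((-(2 * s) : ℝ) : ℂ) • O) *ᵥ φ =
      (((H + ((-(2 * s) : ℝ) : ℂ) • O).minEnergyOn K : ℝ) : ℂ) • φ) :
    -((-O).minEnergyOn K) - w / s ≤ (star φ ⬝ᵥ O *ᵥ φ).re := by
  have hAh : (H + ((-(2 * s) : ℝ) : ℂ) • O).IsHermitian := isHermitian_add_ofReal_smul hH hO _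
  have hcoef : (((-(2 * s) : ℝ)) : ℂ) + (s : ℂ) = (((-s : ℝ)) : ℂ) := by push_cast; ring
  have hAB : H + ((-(2 * s) : ℝ) : ℂ) • O + (s : ℂ) • O = H + ((-s : ℝ) : ℂ) • O := by
    rw [add_assoc, ← add_smul, hcoef]
  have hBh : (H + ((-s : ℝ) : ℂ) • O).IsHermitian := isHermitian_add_ofReal_smul hH hO _
  have hBK : ∀ v ∈ K, (H + ((-s : ℝ) : ℂ) • O) *ᵥ v ∈ K := fun v hv => by
    rw [add_mulVec, smul_mulVec]
    exact K.add_mem (hHK v hv) (K.smul_mem _ (hOK v hv))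
  -- the top eigenvector of `O|K`
  obtain ⟨χ, hχK, hχ1, hχO⟩ := exists_unit_eigen_orderCeiling hO K hOK hK
  -- the bottom of `H - sO` on `K` is at least `e₀ - sΛ`
  obtain ⟨ψ, hψK, hψ1, hψB⟩ := exists_unit_eigen_minEnergyOn hBh K hBK hK
  have hmin : e₀ - s * -((-O).minEnergyOn K) ≤ (H + ((-s : ℝ) : ℂ) • O).minEnergyOn K := by
    rw [← _root_.Literature.MathematicalPhysics.QuantumLattice.re_rayleigh_of_eigen_minEnergyOn
      _ K hψ1 hψB, re_rayleigh_add_ofReal_smul]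
    have h1 := hlow ψ hψK hψ1
    have h2 := re_rayleigh_le_orderCeiling hO K hψK
    rw [hψ1, Complex.one_re, mul_one] at h2
    nlinarith [mul_le_mul_of_nonneg_left h2 hs.le]
  -- the witness `χ` has excess energy `≤ w` in `H - sO`
  have hχE : (star χ ⬝ᵥ (H + ((-(2 * s) : ℝ) : ℂ) • O + (s : ℂ) • O) *ᵥ χ).re ≤
      (H + ((-(2 * s) : ℝ) : ℂ) • O + (s : ℂ) • O).minEnergyOn K + w := by
    rw [hAB, re_rayleigh_add_ofReal_smul, hχO]
    have h1 := hup χ hχK hχ1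
    linarith
  exact groundState_re_rayleigh_ge_of_approx_penalised hAh hO K hs hχK hχ1 hχE hχO.symm.le hφK
    hφ1 hφ

/-- **Theorem 24(a): an ordered ground state depresses the crutched energy linearly.** If a unit
ground state `φ` of `H` on `K` has `re ⟨φ, O φ⟩ ≥ a`, then `E_K(H - tO) ≤ E_K(H) - t a` for every
`t ≥ 0` (variational principle with `φ`). [this work] -/
theorem minEnergyOn_crutch_le [DecidableEq ι] {H O : Matrix ι ι ℂ} (hH : H.IsHermitian)
    (hO : O.IsHermitian)
    (K : Submodule ℂ (ι → ℂ)) {φ : ι → ℂ} (hφK : φ ∈ K) (hφ1 : star φ ⬝ᵥ φ = 1)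
    (hφ : H *ᵥ φ = ((H.minEnergyOn K : ℝ) : ℂ) • φ) {a : ℝ} (ha : a ≤ (star φ ⬝ᵥ O *ᵥ φ).re)
    {t : ℝ} (ht : 0 ≤ t) :
    (H + ((-t : ℝ) : ℂ) • O).minEnergyOn K ≤ H.minEnergyOn K - t * a := by
  have h := minEnergyOn_le_rayleigh_of_mem (isHermitian_add_ofReal_smul hH hO (-t)) K hφK hφ1
  rw [re_rayleigh_add_ofReal_smul,
    _root_.Literature.MathematicalPhysics.QuantumLattice.re_rayleigh_of_eigen_minEnergyOn H K hφ1
      hφ] at h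
  nlinarith [mul_le_mul_of_nonneg_left ha ht]

/-- **Theorem 24(b): a linear energy depression at one `t > 0` forces order on EVERY crutched
ground state.** If `E_K(H - tO) ≤ E_K(H) - t a` then every unit ground state `φ` of `H - tO` on `K`
has `re ⟨φ, O φ⟩ ≥ a` (`E_K(H - tO) = ⟨H⟩_φ - t⟨O⟩_φ ≥ E_K(H) - t⟨O⟩_φ`). [this work] -/
theorem groundState_re_rayleigh_ge_of_minEnergyOn_crutch_le [DecidableEq ι] {H O : Matrix ι ι ℂ}
    (hH : H.IsHermitian) (K : Submodule ℂ (ι → ℂ)) {t a : ℝ} (ht : 0 < t)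
    (hE : (H + ((-t : ℝ) : ℂ) • O).minEnergyOn K ≤ H.minEnergyOn K - t * a)
    {φ : ι → ℂ} (hφK : φ ∈ K) (hφ1 : star φ ⬝ᵥ φ = 1)
    (hφ : (H + ((-t : ℝ) : ℂ) • O) *ᵥ φ =
      (((H + ((-t : ℝ) : ℂ) • O).minEnergyOn K : ℝ) : ℂ) • φ) :
    a ≤ (star φ ⬝ᵥ O *ᵥ φ).re := by
  have h1 := _root_.Literature.MathematicalPhysics.QuantumLattice.re_rayleigh_of_eigen_minEnergyOn
    _ K hφ1 hφ
  rw [re_rayleigh_add_ofReal_smul] at h1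
  have h2 := minEnergyOn_le_rayleigh_of_mem hH K hφK hφ1
  by_contra hlt
  rw [not_le] at hlt
  have := mul_lt_mul_of_pos_left hlt ht
  linarith

/-- **Theorem 24(c): the order of every ground state is monotone along the crutch axis.** For
`t₁ < t₂`, every unit ground state `φ₁` of `H - t₁O` and every unit ground state `φ₂` of `H - t₂O`
on `K` satisfy `re ⟨φ₁, O φ₁⟩ ≤ re ⟨φ₂, O φ₂⟩` (Theorem 17's penalty transfer with penalty
`(t₂ - t₁) O` on top of `H - t₂O`). [this work] -/
theorem crutch_groundState_order_monotone {H O : Matrix ι ι ℂ} (hH : H.IsHermitian)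
    (hO : O.IsHermitian) (K : Submodule ℂ (ι → ℂ)) {t₁ t₂ : ℝ} (ht : t₁ < t₂)
    {φ₁ : ι → ℂ} (hφ₁K : φ₁ ∈ K) (hφ₁1 : star φ₁ ⬝ᵥ φ₁ = 1)
    (hφ₁ : (H + ((-t₁ : ℝ) : ℂ) • O) *ᵥ φ₁ =
      (((H + ((-t₁ : ℝ) : ℂ) • O).minEnergyOn K : ℝ) : ℂ) • φ₁)
    {φ₂ : ι → ℂ} (hφ₂K : φ₂ ∈ K) (hφ₂1 : star φ₂ ⬝ᵥ φ₂ = 1)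
    (hφ₂ : (H + ((-t₂ : ℝ) : ℂ) • O) *ᵥ φ₂ =
      (((H + ((-t₂ : ℝ) : ℂ) • O).minEnergyOn K : ℝ) : ℂ) • φ₂) :
    (star φ₁ ⬝ᵥ O *ᵥ φ₁).re ≤ (star φ₂ ⬝ᵥ O *ᵥ φ₂).re := by
  have hs : 0 < t₂ - t₁ := sub_pos.2 ht
  have hcoef : (((-t₂ : ℝ)) : ℂ) + ((t₂ - t₁ : ℝ) : ℂ) = (((-t₁ : ℝ)) : ℂ) := by push_cast; ring
  have hAB : H + ((-t₂ : ℝ) : ℂ) • O + ((t₂ - t₁ : ℝ) : ℂ) • O = H + ((-t₁ : ℝ) : ℂ) • O := by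
    rw [add_assoc, ← add_smul, hcoef]
  have hφ₁' : (H + ((-t₂ : ℝ) : ℂ) • O + ((t₂ - t₁ : ℝ) : ℂ) • O) *ᵥ φ₁ =
      (((H + ((-t₂ : ℝ) : ℂ) • O + ((t₂ - t₁ : ℝ) : ℂ) • O).minEnergyOn K : ℝ) : ℂ) • φ₁ := by
    rw [hAB]; exact hφ₁
  exact groundState_re_rayleigh_ge_of_penalised (isHermitian_add_ofReal_smul hH hO _) hO K hs
    hφ₁K hφ₁1 hφ₁' le_rfl hφ₂K hφ₂1 hφ₂

end Abstract

/-! ### The Hubbard torus crutched by the reduced `d`-wave interaction -/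

section Hubbard

variable {L : ℕ} [NeZero L]

/-- **`Re ⟨ψ, H₀ ψ⟩ ≤ 4 (a + b) ‖ψ‖²` on the `(a, b)` sector** (`ε(k) ≤ 4`, `⟨n_{kσ}⟩ ≥ 0`; the
mirror image of `re_expect_hubbardTorus_zero_ge`). [folklore] -/
theorem re_expect_hubbardTorus_zero_le (hL : 3 ≤ L) {a b : ℕ} {ψ : Fock (Orb (FermionTorus 2 L))}
    (hψ : IsInSector a b ψ) :
    (star ψ ⬝ᵥ (hubbardTorus 2 L 1 0 *ᵥ ψ)).re ≤ 4 * ((a : ℝ) + b) * (star ψ ⬝ᵥ ψ).re := by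
  rw [hubbardTorus_zero_eq_sum_momentumNumber hL, Matrix.sum_mulVec, dotProduct_sum, Complex.re_sum]
  have hk : ∀ k : TorusSite 2 L,
      (star ψ ⬝ᵥ ((∑ σ : Fin 2, ((torusBand L k : ℝ) : ℂ) • momentumNumber k σ) *ᵥ ψ)).re ≤
        4 * ((star ψ ⬝ᵥ (momentumNumber k 0 *ᵥ ψ)).re +
          (star ψ ⬝ᵥ (momentumNumber k 1 *ᵥ ψ)).re) := by
    intro k
    rw [Matrix.sum_mulVec, dotProduct_sum, Complex.re_sum, Fin.sum_univ_two]
    simp only [Fin.isValue, Matrix.smul_mulVec, dotProduct_smul, smul_eq_mul, Complex.re_ofReal_mul]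
    have h0 := (re_expect_momentumNumber_mem_Icc k 0 ψ).1
    have h1 := (re_expect_momentumNumber_mem_Icc k 1 ψ).1
    have hε := torusBand_le_four L k
    nlinarith
  calc ∑ k : TorusSite 2 L,
        (star ψ ⬝ᵥ ((∑ σ : Fin 2, ((torusBand L k : ℝ) : ℂ) • momentumNumber k σ) *ᵥ ψ)).re
      ≤ ∑ k : TorusSite 2 L, 4 * ((star ψ ⬝ᵥ (momentumNumber k 0 *ᵥ ψ)).re +
          (star ψ ⬝ᵥ (momentumNumber k 1 *ᵥ ψ)).re) := Finset.sum_le_sum fun k _ => hk k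
    _ = 4 * ((a : ℝ) + b) * (star ψ ⬝ᵥ ψ).re := by
        rw [← Finset.mul_sum, Finset.sum_add_distrib, sum_re_expect_momentumNumber_up hψ,
          sum_re_expect_momentumNumber_down hψ]
        ring

/-- **Energy width of the doped sector**: for `L ≥ 3`, `U ≥ 0` and a unit vector `v` of the
sector `(2n, S^z = 0)`, `-8n ≤ re ⟨v, hubbardTorus 2 L 1 U v⟩ ≤ 8n + U L²`. [folklore] -/
theorem re_expect_hubbardTorus_mem_Icc (hL : 3 ≤ L) {U : ℝ} (hU : 0 ≤ U) {n : ℕ}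
    {v : Fock (Orb (FermionTorus 2 L))} (hv : v ∈ szSector (Λ := FermionTorus 2 L) (2 * n) 0)
    (hv1 : star v ⬝ᵥ v = 1) :
    (star v ⬝ᵥ hubbardTorus 2 L 1 U *ᵥ v).re ∈ Set.Icc (-(8 * (n : ℝ))) (8 * n + U * (L : ℝ) ^ 2) := by
  have hs : IsInSector n n v := (mem_szSector_two_mul_zero_iff n v).1 hv
  have hT1 := re_expect_hubbardTorus_zero_ge L hL hs
  have hT2 := re_expect_hubbardTorus_zero_le hL hs
  have hD := re_expect_interaction_torus_mem_Icc (L := L) v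
  rw [hv1, Complex.one_re, mul_one] at hT1 hT2 hD
  rw [hubbardTorus_eq_zero_add_smul_interaction U, re_rayleigh_add_ofReal_smul]
  constructor
  · nlinarith [hD.1, mul_nonneg hU hD.1]
  · nlinarith [hD.2, mul_le_mul_of_nonneg_left hD.2 hU]

/-- **Theorem 23 (the crutched Hubbard model).** `L ≥ 3`, `U ≥ 0`, `2 ≤ 2n ≤ L²`,
`Δ = pairField dWaveFormFactor L`. If SOME nonzero vector `χ` of the sector `K = (2n, S^z = 0)` has
`re ⟨χ, ΔᴴΔ χ⟩ ≥ Λ₀ re⟨χ,χ⟩`, then for every `g > 0` EVERY unit ground state `φ` of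
`hubbardTorus 2 L 1 U - (g/L²) ΔᴴΔ` in `K` has `re ⟨φ, ΔᴴΔ φ⟩ ≥ Λ₀ - 2 (8 + U) L⁴ / g`.
[this work] -/
theorem hubbard_crutch_groundState_order_ge (hL : 3 ≤ L) {U : ℝ} (hU : 0 ≤ U) {n : ℕ}
    (hn : 1 ≤ n) (hnL : 2 * n ≤ L ^ 2) {Λ₀ : ℝ}
    (hΛ₀ : ∃ χ : Fock (Orb (FermionTorus 2 L)), χ ∈ szSector (Λ := FermionTorus 2 L) (2 * n) 0 ∧
      χ ≠ 0 ∧ Λ₀ * (star χ ⬝ᵥ χ).re ≤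
        (star χ ⬝ᵥ ((pairField dWaveFormFactor L)ᴴ * pairField dWaveFormFactor L) *ᵥ χ).re)
    {g : ℝ} (hg : 0 < g) {φ : Fock (Orb (FermionTorus 2 L))} (hφ1 : star φ ⬝ᵥ φ = 1)
    (hφ : IsGroundStateInSector
      (hubbardTorus 2 L 1 U + ((-(g / (L : ℝ) ^ 2) : ℝ) : ℂ) •
        ((pairField dWaveFormFactor L)ᴴ * pairField dWaveFormFactor L)) (2 * n) 0 φ) :
    Λ₀ - 2 * (8 + U) * (L : ℝ) ^ 4 / g ≤
      (star φ ⬝ᵥ ((pairField dWaveFormFactor L)ᴴ * pairField dWaveFormFactor L) *ᵥ φ).re := by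
  have hOh : ((pairField dWaveFormFactor L)ᴴ * pairField dWaveFormFactor L).IsHermitian :=
    isHermitian_conjTranspose_mul_self _
  have hHh := isHermitian_hubbardTorus L 1 U
  have hHK : ∀ v ∈ szSector (Λ := FermionTorus 2 L) (2 * n) 0,
      hubbardTorus 2 L 1 U *ᵥ v ∈ szSector (Λ := FermionTorus 2 L) (2 * n) 0 :=
    fun v hv => hubbardTorus_mulVec_mem_szSector 1 U hv
  have hOK : ∀ v ∈ szSector (Λ := FermionTorus 2 L) (2 * n) 0,
      ((pairField dWaveFormFactor L)ᴴ * pairField dWaveFormFactor L) *ᵥ v ∈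
        szSector (Λ := FermionTorus 2 L) (2 * n) 0 := fun v hv => by
    rw [← mulVec_mulVec]
    have h := PairTower.pairField_conjTranspose_mulVec_mem_szSector dWaveFormFactor
      (PairTower.pairField_mulVec_mem_szSector dWaveFormFactor hv)
    rwa [Nat.sub_add_cancel (by omega : 2 ≤ 2 * n)] at h
  obtain ⟨χ, hχK, hχ0, hχ⟩ := hΛ₀
  have hKne : szSector (Λ := FermionTorus 2 L) (2 * n) 0 ≠ ⊥ :=
    (Submodule.ne_bot_iff _).2 ⟨χ, hχK, hχ0⟩
  -- `Λ₀ ≤ Λ`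
  have hΛ : Λ₀ ≤ -((-((pairField dWaveFormFactor L)ᴴ * pairField dWaveFormFactor L)).minEnergyOn
      (szSector (Λ := FermionTorus 2 L) (2 * n) 0)) := by
    have h1 := re_rayleigh_le_orderCeiling hOh _ hχK
    have hpos := re_star_dotProduct_self_pos hχ0
    exact le_of_mul_le_mul_right (hχ.trans h1) hpos
  -- the coupling `g / L² = 2s`
  have hL0 : (0 : ℝ) < L := by exact_mod_cast (by omega : 0 < L)
  set s : ℝ := g / (2 * (L : ℝ) ^ 2) with hs
  have hs0 : 0 < s := by positivity
  have hcoup : -(g / (L : ℝ) ^ 2) = -(2 * s) := by rw [hs]; field_simp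
  have hφ' := hφ.2.2
  rw [hcoup] at hφ'
  -- energy width `w = 16 n + U L²` above `e₀ = -8n`
  have hlow : ∀ v ∈ szSector (Λ := FermionTorus 2 L) (2 * n) 0, star v ⬝ᵥ v = 1 →
      -(8 * (n : ℝ)) ≤ (star v ⬝ᵥ hubbardTorus 2 L 1 U *ᵥ v).re :=
    fun v hv hv1 => (re_expect_hubbardTorus_mem_Icc hL hU hv hv1).1
  have hup : ∀ v ∈ szSector (Λ := FermionTorus 2 L) (2 * n) 0, star v ⬝ᵥ v = 1 →
      (star v ⬝ᵥ hubbardTorus 2 L 1 U *ᵥ v).re ≤ -(8 * (n : ℝ)) + (16 * n + U * (L : ℝ) ^ 2) :=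
    fun v hv hv1 => by have := (re_expect_hubbardTorus_mem_Icc hL hU hv hv1).2; linarith
  have key := groundState_re_rayleigh_ge_orderCeiling_sub hHh hOh _ hHK hOK hKne hlow hup hs0 hφ.1
    hφ1 hφ'
  -- `w / s = (16n + UL²) 2L²/g ≤ 2(8+U)L⁴/g`
  have hnL' : (2 * n : ℝ) ≤ (L : ℝ) ^ 2 := by exact_mod_cast hnL
  have hw : (16 * (n : ℝ) + U * (L : ℝ) ^ 2) / s ≤ 2 * (8 + U) * (L : ℝ) ^ 4 / g := by
    have h1 : (16 * (n : ℝ) + U * (L : ℝ) ^ 2) / s =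
        (16 * (n : ℝ) + U * (L : ℝ) ^ 2) * (2 * (L : ℝ) ^ 2) / g := by
      rw [hs]; field_simp
    rw [h1]
    refine div_le_div_of_nonneg_right ?_ hg.le
    nlinarith [sq_nonneg (L : ℝ), mul_nonneg hU (sq_nonneg (L : ℝ))]
  linarith

/-- **Corollary (the summit's conclusion on the crutch axis).** `U ≥ 0`, `δ ∈ (0, 1/2)`, and a
KINEMATIC FLOOR: for all sides `L ≥ L₁` some nonzero vector of the doped sector
`(2⌊(1-δ)L²/2⌋, S^z = 0)` has `re ⟨χ, ΔᴴΔ χ⟩ ≥ c L⁴ re⟨χ,χ⟩` (`c > 0`; Theorem 22 gives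
`c = (1-δ)/4096`, `L₁ = 32`). Then for every `g ≥ 4(8+U)/c`, EVERY family `ψ_L` of normalised
sector ground states of the crutched Hamiltonians `hubbardTorus 2 L 1 U - (g/L²) ΔᴴΔ` (hypotheses
at the even sides `L = n+1`, the only ones the conclusion sees) has `d`-wave long-range order in
the summit's exact sense. [this work] -/
theorem hubbard_crutch_hasLongRangeOrder {U : ℝ} (hU : 0 ≤ U) {δ : ℝ}
    (hδ : δ ∈ Set.Ioo (0 : ℝ) (1 / 2)) {c : ℝ} (hc : 0 < c) {L₁ : ℕ}
    (hfloor : ∀ n : ℕ, L₁ ≤ n + 1 → ∃ χ : Fock (Orb (FermionTorus 2 (n + 1))),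
      χ ∈ szSector (Λ := FermionTorus 2 (n + 1)) (2 * ⌊(1 - δ) * ((n + 1 : ℕ) : ℝ) ^ 2 / 2⌋₊) 0 ∧
        χ ≠ 0 ∧ c * ((n + 1 : ℕ) : ℝ) ^ 4 * (star χ ⬝ᵥ χ).re ≤
          (star χ ⬝ᵥ ((pairField dWaveFormFactor (n + 1))ᴴ * pairField dWaveFormFactor (n + 1))
            *ᵥ χ).re)
    {g : ℝ} (hg : 4 * (8 + U) / c ≤ g) (ψ : ∀ L, Fock (Orb (FermionTorus 2 L)))
    (hψ : ∀ n : ℕ, Even (n + 1) → star (ψ (n + 1)) ⬝ᵥ ψ (n + 1) = 1 ∧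
      IsGroundStateInSector
        (hubbardTorus 2 (n + 1) 1 U + ((-(g / ((n + 1 : ℕ) : ℝ) ^ 2) : ℝ) : ℂ) •
          ((pairField dWaveFormFactor (n + 1))ᴴ * pairField dWaveFormFactor (n + 1)))
        (2 * ⌊(1 - δ) * ((n + 1 : ℕ) : ℝ) ^ 2 / 2⌋₊) 0 (ψ (n + 1))) :
    HasLongRangeOrder (fun k => halfOpenBox 2 (2 * k))
      (fun k => torusPullback (pairFieldCorr dWaveFormFactor ψ) (2 * k)) := by
  have h8U : 0 < 8 + U := by linarith
  have hg0 : 0 < g := lt_of_lt_of_le (by positivity) hg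
  refine hasLongRangeOrder_even_of_le dWaveFormFactor ψ (fun n hn => (hψ n hn).1)
    (a := c / 2) (by positivity) (max L₁ 3) fun n hn hKn => ?_
  rw [sum_pairFieldCorr_succ]
  obtain ⟨hψ1, hgs⟩ := hψ n hn
  have hL3 : 3 ≤ n + 1 := le_trans (le_max_right _ _) hKn
  have hL1 : L₁ ≤ n + 1 := le_trans (le_max_left _ _) hKn
  have hn1 : 1 ≤ ⌊(1 - δ) * ((n + 1 : ℕ) : ℝ) ^ 2 / 2⌋₊ := by
    have := two_le_dopedN hδ.2 (L := n + 1) (by omega)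
    omega
  have hnL : 2 * ⌊(1 - δ) * ((n + 1 : ℕ) : ℝ) ^ 2 / 2⌋₊ ≤ (n + 1) ^ 2 := by
    have h1 : (⌊(1 - δ) * ((n + 1 : ℕ) : ℝ) ^ 2 / 2⌋₊ : ℝ) ≤ (1 - δ) * ((n + 1 : ℕ) : ℝ) ^ 2 / 2 :=
      Nat.floor_le (by nlinarith [hδ.2, sq_nonneg ((n + 1 : ℕ) : ℝ)])
    have h2 : (2 : ℝ) * (⌊(1 - δ) * ((n + 1 : ℕ) : ℝ) ^ 2 / 2⌋₊ : ℝ) ≤ ((n + 1 : ℕ) : ℝ) ^ 2 := by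
      nlinarith [hδ.1, sq_nonneg ((n + 1 : ℕ) : ℝ)]
    exact_mod_cast h2
  obtain ⟨χ, hχK, hχ0, hχ⟩ := hfloor n hL1
  have key := hubbard_crutch_groundState_order_ge (L := n + 1) hL3 hU hn1 hnL ⟨χ, hχK, hχ0, hχ⟩
    hg0 hψ1 hgs
  have hcomp : 2 * (8 + U) * ((n + 1 : ℕ) : ℝ) ^ 4 / g ≤ c / 2 * ((n + 1 : ℕ) : ℝ) ^ 4 := by
    rw [div_le_iff₀ hg0]
    have h1 : 4 * (8 + U) ≤ g * c := by rwa [div_le_iff₀ hc] at hg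
    nlinarith [pow_nonneg (Nat.cast_nonneg (n + 1) : (0 : ℝ) ≤ ((n + 1 : ℕ) : ℝ)) 4]
  simp only [expect]
  linarith

end Hubbard

end Summit.HubbardSuperconductivity.HubbardSuperconductivity.Theorems.CrutchAxis
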